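import Mathlib.Algebra.BigOperators.Intervals
import Summits.Ventures.LatticeQCDFlow.Scaling.SwapLogRatioMoments

/-!
HONEST FRAMING: exact (Metropolis-corrected) sampling algorithms for lattice gauge theory; figures
of merit are autocorrelation/cost numbers at stated couplings and volumes; no continuum-physics
claim.

# SwapLogRatioSumRule — AN EXACT SUM RULE FOR THE SWAP LOG OF A TEMPERING LADDER: `Σ_j ⟨ΔS⟩_j/(c_{j+1} − c_j) =
# ψ′(c_K) − ψ′(c_0)` (THE MEAN-STATISTIC DROP BETWEEN THE END REPLICAS), `Σ_j ⟨ΔS⟩_j = δ·(ψ′(c_K) − ψ′(c_0))` FOR A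
# UNIFORM LADDER, AND `m·(c_K − c_0)²/K ≤ Σ_j ⟨ΔS⟩_j` UNDER A VARIANCE FLOOR (row 22 `su3-ptbc`, GEN-8, ours; sequel of
# `SwapLogRatioMoments`)

Venture `LatticeQCDFlow` (cell pub-lqcd), topic `Scaling`; FANOUT row 22 (`su3-ptbc`).  NEW WORK of the cell over
`SwapLogRatioMoments` (`swapLogRatio`, `integral_swapLogRatio`: `⟨ΔS⟩ = (t−s)(ψ′(t) − ψ′(s))`, `mul_sq_le_integral_swapLogRatio`)
in lean-2's `SwapAcceptanceLaw` setting (`μ_u = μ.tilted(u·X)`, `ψ = cgf X μ`, `∫ X dμ_u = ψ′(u)`).  Nothing is cited as a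
fact; no `native_decide`.

THE POINT (exact statements, value-free).  A replica ladder `c_0 < c_1 < … < c_K` of the linear tempering family (PTBC: defect
couplings, `X = −`defect action) swaps neighbours `j, j+1`; at stationarity the mean log-ratio of pair `j` is
`⟨ΔS⟩_j = (c_{j+1} − c_j)(ψ′(c_{j+1}) − ψ′(c_j))` (`SwapLogRatioMoments`).  Hence:
* **`sum_meanSwap_div_gap`** — `Σ_{j<K} ⟨ΔS⟩_j/(c_{j+1} − c_j) = ψ′(c_K) − ψ′(c_0) = ∫X dμ_{c_K} − ∫X dμ_{c_0}` (telescoping;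
  any strictly increasing ladder): the swap log alone determines the mean-statistic drop between the two END replicas — an
  exact consistency check of a run's per-pair `⟨dS⟩` against two single-replica means (for PTBC: the mean defect action at the
  open and at the periodic end).
* **`sum_meanSwap_uniform`** — uniform spacing `c_j = a + j·δ`: `Σ_{j<K} ⟨ΔS⟩_j = δ·(ψ′(a + Kδ) − ψ′(a))`.
* **`sum_meanSwap_ge`** — under a variance floor `m ≤ Var_{μ_u}X` on `[c_0, c_K]`: `Σ_j ⟨ΔS⟩_j ≥ m·Σ_j (c_{j+1} − c_j)²
  ≥ m·(c_K − c_0)²/K` (Cauchy–Schwarz), with equality in the last step iff the ladder is uniform — the total mean swap action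
  of a `K`-pair ladder across a fixed coupling window is at least `m·(window)²/K`, least for the uniform ladder.
Reading for the card (report-only): with `records.jsonl`'s per-pair `dS`, `Σ_pairs ⟨dS⟩/Δc` should reproduce the measured
`⟨S_defect⟩_open − ⟨S_defect⟩_periodic` (sign per the family's orientation) within errors — a swap-bookkeeping check
independent of the sign rule and of `⟨e^{−ΔS}⟩ = 1`.  NOT CLAIMED: anything about acceptances; any number of a run.
-/

noncomputable section

open MeasureTheory ProbabilityTheory Real Finset

namespace Summit.Ventures.LatticeQCDFlow.Scaling

variable {Ω : Type*} [MeasurableSpace Ω] {μ : Measure Ω} [IsProbabilityMeasure μ] {X : Ω → ℝ}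

/-- The stationary mean swap log-ratio of the pair at tilts `s`, `t`. [ours] -/
def meanSwap (X : Ω → ℝ) (μ : Measure Ω) (s t : ℝ) : ℝ :=
  ∫ p, swapLogRatio X s t p ∂((μ.tilted fun ω => s * X ω).prod (μ.tilted fun ω => t * X ω))

/-- `⟨ΔS⟩ = (t−s)(ψ′(t) − ψ′(s))` in the `meanSwap` notation. [ours] -/
theorem meanSwap_eq (hXm : Measurable X) (hXb : ∃ C, ∀ ω, |X ω| ≤ C) (s t : ℝ) :
    meanSwap X μ s t = (t - s) * (deriv (cgf X μ) t - deriv (cgf X μ) s) :=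
  integral_swapLogRatio hXm hXb s t

/-- `⟨ΔS⟩/(t − s) = ψ′(t) − ψ′(s)` for `s ≠ t`. [ours] -/
theorem meanSwap_div_gap (hXm : Measurable X) (hXb : ∃ C, ∀ ω, |X ω| ≤ C) {s t : ℝ} (hst : s ≠ t) :
    meanSwap X μ s t / (t - s) = deriv (cgf X μ) t - deriv (cgf X μ) s := by
  rw [meanSwap_eq hXm hXb, mul_div_cancel_left₀ _ (sub_ne_zero.2 hst.symm)]

/-- **THE SUM RULE: `Σ_{j<K} ⟨ΔS⟩_j/(c_{j+1} − c_j) = ψ′(c_K) − ψ′(c_0)`** for every ladder with `c_j ≠ c_{j+1}`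
(telescoping). [ours] -/
theorem sum_meanSwap_div_gap (hXm : Measurable X) (hXb : ∃ C, ∀ ω, |X ω| ≤ C) (c : ℕ → ℝ)
    (hc : ∀ j, c j ≠ c (j + 1)) (K : ℕ) :
    ∑ j ∈ range K, meanSwap X μ (c j) (c (j + 1)) / (c (j + 1) - c j)
      = deriv (cgf X μ) (c K) - deriv (cgf X μ) (c 0) := by
  simp_rw [meanSwap_div_gap hXm hXb (hc _)]
  exact sum_range_sub (fun j => deriv (cgf X μ) (c j)) K

/-- In terms of the mean statistic: `Σ_{j<K} ⟨ΔS⟩_j/(c_{j+1} − c_j) = ∫X dμ_{c_K} − ∫X dμ_{c_0}`. [ours] -/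
theorem sum_meanSwap_div_gap_eq_integral (hXm : Measurable X) (hXb : ∃ C, ∀ ω, |X ω| ≤ C) (c : ℕ → ℝ)
    (hc : ∀ j, c j ≠ c (j + 1)) (K : ℕ) :
    ∑ j ∈ range K, meanSwap X μ (c j) (c (j + 1)) / (c (j + 1) - c j)
      = (∫ ω, X ω ∂(μ.tilted fun ω => c K * X ω)) - ∫ ω, X ω ∂(μ.tilted fun ω => c 0 * X ω) := by
  rw [sum_meanSwap_div_gap hXm hXb c hc K, integral_tilted_eq_deriv_cgf hXm hXb, integral_tilted_eq_deriv_cgf hXm hXb]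

/-- **UNIFORM LADDER: `Σ_{j<K} ⟨ΔS⟩_j = δ·(ψ′(a + Kδ) − ψ′(a))`** (`c_j = a + jδ`). [ours] -/
theorem sum_meanSwap_uniform (hXm : Measurable X) (hXb : ∃ C, ∀ ω, |X ω| ≤ C) (a δ : ℝ) (K : ℕ) :
    ∑ j ∈ range K, meanSwap X μ (a + j * δ) (a + (j + 1) * δ)
      = δ * (deriv (cgf X μ) (a + K * δ) - deriv (cgf X μ) a) := by
  have e : ∀ j : ℕ, meanSwap X μ (a + j * δ) (a + (j + 1) * δ)
      = δ * (deriv (cgf X μ) (a + ((j + 1 : ℕ) : ℝ) * δ) - deriv (cgf X μ) (a + (j : ℝ) * δ)) := by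
    intro j
    rw [meanSwap_eq hXm hXb]
    push_cast
    ring
  simp_rw [e, ← mul_sum]
  rw [sum_range_sub (fun j => deriv (cgf X μ) (a + (j : ℝ) * δ)) K]
  simp

/-- **VARIANCE FLOOR ⇒ `Σ_j ⟨ΔS⟩_j ≥ m·Σ_j (c_{j+1} − c_j)²`** (increasing ladder, `m ≤ Var_{μ_u}X` on `[c_0, c_K]`). [ours] -/
theorem sum_meanSwap_ge_sum_sq (hXm : Measurable X) (hXb : ∃ C, ∀ ω, |X ω| ≤ C) {c : ℕ → ℝ} (hc : Monotone c)
    {m : ℝ} (K : ℕ) (hm : ∀ u ∈ Set.Icc (c 0) (c K), m ≤ variance X (μ.tilted fun ω => u * X ω)) :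
    m * ∑ j ∈ range K, (c (j + 1) - c j) ^ 2 ≤ ∑ j ∈ range K, meanSwap X μ (c j) (c (j + 1)) := by
  rw [mul_sum]
  refine sum_le_sum fun j hj => ?_
  have hjK := mem_range.1 hj
  refine mul_sq_le_integral_swapLogRatio hXm hXb (hc (Nat.le_succ j)) fun u hu => hm u ⟨?_, ?_⟩
  · exact (hc (Nat.zero_le j)).trans hu.1
  · exact hu.2.trans (hc (by omega))

/-- **HENCE `m·(c_K − c_0)²/K ≤ Σ_j ⟨ΔS⟩_j`** (`K ≥ 1`, `m ≥ 0`, increasing ladder, variance floor `m`): the total mean swap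
action across a fixed window is at least `m·window²/K`, the uniform ladder's value under a constant variance. [ours] -/
theorem sum_meanSwap_ge (hXm : Measurable X) (hXb : ∃ C, ∀ ω, |X ω| ≤ C) {c : ℕ → ℝ} (hc : Monotone c)
    {m : ℝ} (hm0 : 0 ≤ m) {K : ℕ} (hK : 0 < K)
    (hm : ∀ u ∈ Set.Icc (c 0) (c K), m ≤ variance X (μ.tilted fun ω => u * X ω)) :
    m * (c K - c 0) ^ 2 / K ≤ ∑ j ∈ range K, meanSwap X μ (c j) (c (j + 1)) := by
  have hK' : (0 : ℝ) < K := by exact_mod_cast hK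
  have h1 := sum_meanSwap_ge_sum_sq hXm hXb hc K hm
  -- Cauchy–Schwarz for the gaps: `(c_K − c_0)² ≤ K·Σ_{j<K} (c_{j+1} − c_j)²`
  have h2 : (c K - c 0) ^ 2 ≤ K * ∑ j ∈ range K, (c (j + 1) - c j) ^ 2 := by
    have h := sum_mul_sq_le_sq_mul_sq (range K) (fun _ => (1 : ℝ)) (fun j => c (j + 1) - c j)
    simp only [one_mul, one_pow, sum_const, card_range, nsmul_eq_mul, mul_one] at h
    rw [sum_range_sub] at h
    exact h
  rw [div_le_iff₀ hK']
  calc m * (c K - c 0) ^ 2 ≤ m * (K * ∑ j ∈ range K, (c (j + 1) - c j) ^ 2) := mul_le_mul_of_nonneg_left h2 hm0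
    _ = (m * ∑ j ∈ range K, (c (j + 1) - c j) ^ 2) * K := by ring
    _ ≤ (∑ j ∈ range K, meanSwap X μ (c j) (c (j + 1))) * K := mul_le_mul_of_nonneg_right h1 hK'.le

end Summit.Ventures.LatticeQCDFlow.Scaling

end
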